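import Summits.QuantumAdvantage.QuantumAdvantage.Theorems.CubicForrelationNearExactIsExactTenDigits
import Summits.QuantumAdvantage.QuantumAdvantage.Theorems.CubicForrelationNearExactIsExactIsolationSmallN

/-!
# Crux `CubicForrelation.NearExactIsExact` (stmt-QuantumAdvantage-14043) — the mixed-digit Walsh tower on 11 bits

Certificate seat `b2b-cforr-cert` (gen 14).  HONEST FRAMING: a theorem about cubic Boolean functions on 11 bits — NOT summit
progress.  It is the `n = 11` companion of `td_digitOne` (10 bits) and is the input for the n = 12 window theorem `θ₁₂ ≤ 59/64`
(the restriction of a 12-bit cubic to a coordinate hyperplane is an 11-bit cubic).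

For a CUBIC `g : 𝔽₂¹¹ → 𝔽₂` every Walsh value is a multiple of `16` (Ax/McEliece): `W_g = 16·u`.  Writing the Euclidean digits
`d₀ = u mod 2`, `d₁ = ⌊u/2⌋ mod 2`, the Boolean function `d₁` has algebraic degree `≤ 2` (`el_digitOne`), with no hypothesis on `d₀`
(which is affine by the landed tower `stub_walshTower`).

Proof (Poisson + Ax + Möbius, verbatim the 10-bit argument).  By Möbius inversion (`bb_moebius_isDegLeFun`) it suffices that
`#{x ∈ E_I : d₁(x) = 1}` is even for every coordinate cube `E_I` with `|I| ≥ 3`.  Poisson (`bb_poisson`) and Ax on the complementary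
cube (`stub_axParity`, `d = 3`) give `16·Σ_{E_I} u = 2^{|I|}·2^{⌈(11−|I|)/3⌉}·z`, so `Σ_{E_I} u ≡ 0 (mod 4)` for `|I| ≥ 3`; since
`u = 2⌊u/2⌋ + d₀` pointwise and `#{d₀ = 1 on E_I} ≡ 0 (mod 4)` (Ax for the affine `d₀`), `Σ_{E_I} ⌊u/2⌋` is even.
Numerical sanity check (seat folder `work/c/checks.c`): on random 11-bit cubics the digit degrees are `≤ 1, 2, 4`.

References: J. Ax, Amer. J. Math. 86 (1964); R. J. McEliece, Discrete Math. 3 (1972); C. Carlet, *Boolean Functions for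
Cryptography and Coding Theory*, CUP 2021, §2.2 and §4.1.  Everything below is proved from Mathlib and the tree; axioms are
the standard three.
-/

set_option linter.dupNamespace false -- D-0017: single-problem summit ⇒ `QuantumAdvantage.QuantumAdvantage` by design

noncomputable section

namespace Summit.QuantumAdvantage.QuantumAdvantage.Theorems.CubicForrelation.NearExactIsExact

open Finset
open Literature.Computability.QuantumComplexity
open Literature.Computability.QuantumComplexity.DerivativeWalsh (W)

/-- Every Walsh value of a cubic on 11 bits is a multiple of `16`: `W_g = 2⁴·u` for an integer-valued `u`
(Ax/McEliece via the landed `tw_base`, `⌈(11+2)/3⌉ = 4`). [cite: Carlet2020, §4.1] -/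
theorem el_base (g : (Fin 11 → Bool) → Bool) (hg : IsDegLeFun 3 g) :
    ∃ u : (Fin 11 → Bool) → ℤ, ∀ x, W (fun y => signOf (g y)) x = (2 : ℝ) ^ 4 * (u x : ℝ) :=
  tw_base g hg 4 (by norm_num)

/-- The cube sums of `u = W_g/16` for a cubic `g` on 11 bits: `16·Σ_{E_I} u = 2^{|I|}·2^{⌈(11−|I|)/3⌉}·z` (Poisson over
`E_I`, Ax on `E_{Iᶜ}`). [cite: Carlet2020, §4.1] -/
theorem el_cube_sum (g : (Fin 11 → Bool) → Bool) (u : (Fin 11 → Bool) → ℤ) (hg : IsDegLeFun 3 g)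
    (hu : ∀ x, W (fun y => signOf (g y)) x = (2 : ℝ) ^ 4 * (u x : ℝ)) (I : Finset (Fin 11)) :
    ∃ z : ℤ, (2 : ℤ) ^ 4 * ∑ x ∈ {x : Fin 11 → Bool | ∀ i, x i = true → i ∈ I}, u x =
      2 ^ #I * (2 ^ ((11 - #I + 2) / 3) * z) := by
  have hP := bb_poisson (fun y => signOf (g y)) I
  obtain ⟨z, hz⟩ := stub_axParity 11 3 g Iᶜ (by norm_num) hg
  have hj : #Iᶜ = 11 - #I := by rw [card_compl, Fintype.card_fin]
  rw [hj, show (11 - #I + 3 - 1) / 3 = (11 - #I + 2) / 3 by omega] at hz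
  rw [sum_congr rfl fun x _ => hu x, ← mul_sum, hz] at hP
  refine ⟨z, ?_⟩
  have h' : (((2 : ℤ) ^ 4 * ∑ x ∈ {x : Fin 11 → Bool | ∀ i, x i = true → i ∈ I}, u x : ℤ) : ℝ) =
      (((2 : ℤ) ^ #I * (2 ^ ((11 - #I + 2) / 3) * z) : ℤ) : ℝ) := by
    push_cast at hP ⊢
    linarith
  exact_mod_cast h'

/-- **Digit zero (11 bits).** For cubic `g` on 11 bits with `W_g = 16·u`, the parity `x ↦ [u(x) odd]` has algebraic degree `≤ 1`
(the landed tower `stub_walshTower` at `j = 4`). [cite: Carlet2020, §4.1] -/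
theorem el_digitZero (g : (Fin 11 → Bool) → Bool) (u : (Fin 11 → Bool) → ℤ) (hg : IsDegLeFun 3 g)
    (hu : ∀ x, W (fun y => signOf (g y)) x = (2 : ℝ) ^ 4 * (u x : ℝ)) :
    IsDegLeFun 1 (fun x => decide (Odd (u x))) :=
  stub_walshTower stub_axParity 11 4 1 g u hg hu (by intro k hk hkn; omega)

/-- **Digit one (11 bits).** For cubic `g` on 11 bits with `W_g = 16·u`, the Boolean function `x ↦ [⌊u(x)/2⌋ odd]` (the second
Euclidean binary digit of `u`, with NO assumption on the first) has algebraic degree `≤ 2`. [this work; cite: Carlet2020,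
§4.1 (McEliece) for the divisibility input] -/
theorem el_digitOne (g : (Fin 11 → Bool) → Bool) (u : (Fin 11 → Bool) → ℤ) (hg : IsDegLeFun 3 g)
    (hu : ∀ x, W (fun y => signOf (g y)) x = (2 : ℝ) ^ 4 * (u x : ℝ)) :
    IsDegLeFun 2 (fun x => decide (Odd (u x / 2))) := by
  have hP0 : IsDegLeFun 1 (fun x => decide (Odd (u x))) := el_digitZero g u hg hu
  refine bb_moebius_isDegLeFun 2 _ fun I hI => ?_
  have hk : #I ≤ 11 := (card_le_univ I).trans_eq (Fintype.card_fin _)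
  -- the cube sum of `u` is divisible by 4
  obtain ⟨z, hz⟩ := el_cube_sum g u hg hu I
  have h4 : (2 : ℤ) ^ 2 ∣ ∑ x ∈ {x : Fin 11 → Bool | ∀ i, x i = true → i ∈ I}, u x :=
    td_dvd_of_balance (by omega) hz
  -- the number of odd `u` on the cube is divisible by 4
  obtain ⟨z', hz'⟩ := td_count_cube (le_refl 1) (fun x => decide (Odd (u x))) hP0 I
  rw [show (#I + 1 - 1) / 1 = #I by simp] at hz'
  have hA : (4 : ℤ) ∣ #{x : Fin 11 → Bool | (∀ i, x i = true → i ∈ I) ∧ decide (Odd (u x)) = true} := by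
    obtain ⟨e, he⟩ : ∃ e, #I = e + 3 := ⟨#I - 3, by omega⟩
    rw [he, show (2 : ℤ) ^ (e + 3) = 2 ^ e * 8 by rw [pow_add]; norm_num] at hz'
    refine ⟨2 ^ e * (1 - z'), ?_⟩
    linarith
  -- split `u = 2⌊u/2⌋ + [u odd]` under the sum
  have hsplit : ∑ x ∈ {x : Fin 11 → Bool | ∀ i, x i = true → i ∈ I}, u x =
      2 * ∑ x ∈ {x : Fin 11 → Bool | ∀ i, x i = true → i ∈ I}, u x / 2 +
        #{x : Fin 11 → Bool | (∀ i, x i = true → i ∈ I) ∧ decide (Odd (u x)) = true} := by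
    rw [sum_congr rfl fun x _ => td_two_mul_div_add (u x), sum_add_distrib, ← mul_sum, td_sum_ite_odd, filter_filter]
    simp only [decide_eq_true_eq]
  have hE : Even (∑ x ∈ {x : Fin 11 → Bool | ∀ i, x i = true → i ∈ I}, u x / 2) := by
    rw [pow_two] at h4
    obtain ⟨q, hq⟩ := h4
    obtain ⟨a, ha⟩ := hA
    refine ⟨q - a, ?_⟩
    linarith
  have hE' := (tw_even_sum_iff _ (fun x => u x / 2)).1 hE
  rw [filter_filter] at hE'
  simpa only [decide_eq_true_eq] using hE'

end Summit.QuantumAdvantage.QuantumAdvantage.Theorems.CubicForrelation.NearExactIsExact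

end
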